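import Literature.NumberTheory.EllipticCurves.TowerTorsionCutInputsProofs
import Literature.NumberTheory.EllipticCurves.ZpExtensionEisensteinPiOrdinaryFamiliesProofs
import Literature.NumberTheory.EllipticCurves.ZpExtensionEisensteinPiLevelInvariantsBoundProofs
import Literature.NumberTheory.GaloisRepresentations.LocalGlobalCohomologyFiniteProofs
import Literature.NumberTheory.EllipticCurves.ZpExtensionEisensteinOrdinaryFilTransferProofs
import Literature.NumberTheory.EllipticCurves.TorsionFilAtAdaptedBasisProofs
import HarnessLib

/-!
# The torsion-cut inputs (hTor), (hF2), (hLift) for the curve's `π`-adic Eisenstein tower at a place `w ∣ p`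
# (theorems only)

`Proofs` file (theorems only; no definition, no named fact, no instance, no `sorry`).  Topic `NumberTheory/EllipticCurves`
(D1 road of cell `pub/bsd-print-x9`; Howard's H.5(b) for the Eisenstein specialisation at the places `v ∣ p`, the UNIFORM
«`ι` on the characteristic-`p` level» road of `x9-p1-w3`, brick (F1b-INST), instance layer).

INSTANCE of the generic layer `TowerTorsionCutInputsProofs` (and of F2 `TowerTorsionCutPresentedProofs`) for the curve's
`π`-adic refinement datum `D := E.eisensteinPiRefinementDatum κ hm` (levels `D.Level i = T^{(host i)} ⧸ π^i · T^{(host i)}` of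
Howard's `T_𝔮 = T_p E ⊗ Λ/(T^m + p)(ψ)`, scalar ring `S_𝔮 = Λ/(T^m + p)`, uniformiser `D.π = [T]`) LOCALISED at a finite place
`w` (`ρ i := GaloisRep.toLocal w (D.levelRep i)`, presentation `f a b := localIntertwining … (D.map a b) …` so that
`H¹(f a b) = D.mapH w a b`), with the plus parts `Fil i := E.piFil κ hm Φ i` of an ordinary datum `Φ` at `w`
(`ZpExtensionEisensteinH3OrdinaryProofs`):

* §1 the presented-tower identities of the local family (`hid`, `hcomp`, `hsq`, `hinj`, `hsurj`, `hex`, `hpow`, `hfR` — from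
  `PiAdicRefinement`), the Eisenstein relation `hqm` (`π^m + p = 0` in `S_𝔮`), the `S_𝔮`-stability `hFilR` of the plus parts,
  finiteness of the local `H¹` of levels and graded levels;
* §2 **(hTor-inst)** `WeierstrassCurve.piTorsionCut_hTor`: F2's first `H¹`-hypothesis with `r := 2 p^s`, from (F4a)
  `OrdinaryFiltration.pi_pow_smul_mem_piFil_of_forall_toLocal_levelRep_sub_mem` («`π^{2p^s}` kills `H⁰(K_w, gr_w(T/π^iT))`»,
  `κ(g₀) = p^s`, `2p^s < m`) and F3's (map)/(ONTO)/(SAT);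
* §3 **(hF2-inst)** `WeierstrassCurve.piTorsionCut_hF2`: F2's second `H¹`-hypothesis, from an endomorphism `t i` of the plus part
  acting as `π^c` and killing `H²(K_w, Fil_i)` (hypothesis `hH2Fil`, to be discharged by the `H²`-counts (F4c));
  `WeierstrassCurve.exists_piFil_subPowFamily_apply` supplies such `t`;
* §4 **(hLift-inst)** `WeierstrassCurve.piTorsionCut_hLift`: F2's third `H¹`-hypothesis, from
  `hH2 : galoisCohomology.scalarMap … 2 (D.π ^ c') = 0` on the local `H²` of every level ((F4c)).

References: B. Howard, Compositio Math. 140 (2004), §1.3 H.5(b), Def. 1.1.3, §1.6, §3.1, Lemma 3.2.7 (arXiv:1202.6340 p. 5,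
p. 7 L96–97, p. 12 L29–55, p. 15–16); R. Greenberg, LNM 1716 (1999), §2; Serre, *Galois Cohomology* (1997), I §2.2–2.3,
II §5.2.  No summit statement is proved; BSD is not proved by any of this.
-/

set_option autoImplicit false

noncomputable section

open Function NumberField IsDedekindDomain Field
open scoped NumberField ContRepresentation

namespace WeierstrassCurve

open Literature.NumberTheory.EllipticCurves Literature.NumberTheory.GaloisRepresentations
open Literature.NumberTheory.GaloisRepresentations.DiscreteGaloisModule
open Literature.NumberTheory.EllipticCurves.ZpExtension (EisensteinLevel OrdinaryFiltration)
open Literature.NumberTheory.GaloisCohomology.Howard2004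
open Literature.NumberTheory.EllipticCurves.Tower

variable {K : Type} [Field K] [NumberField K] (E : WeierstrassCurve K) [E.IsElliptic] {p : ℕ} [hp : Fact p.Prime]
  (κ : Literature.NumberTheory.EllipticCurves.ZpExtension K p) {m : ℕ} (hm : 1 ≤ m) (w : HeightOneSpectrum (𝓞 K))
  (Φ : OrdinaryFiltration (fun j ↦ E.torsionGaloisModule ((p : ℤ) ^ j)) (fun j ↦ E.torsionGaloisModuleReduce p j) w)

/-! ## §1 The local presented family of the `π`-adic refinement datum: identities and bookkeeping -/

/-- The local presentation map is `D.map a b` on elements. [cite: Howard2004HeegnerKolyvagin, Def. 1.1.3 (arXiv p. 5 L93–99)] -/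
theorem piLocalMap_apply (a b : ℕ) (x : (E.eisensteinPiRefinementDatum κ hm).Level a) :
    localIntertwining ((E.eisensteinPiRefinementDatum κ hm).levelRep a) ((E.eisensteinPiRefinementDatum κ hm).levelRep b) w
        ((E.eisensteinPiRefinementDatum κ hm).map a b).toAddMonoidHom
        ((E.eisensteinPiRefinementDatum κ hm).map_equivariant_toLocal w a b) x =
      (E.eisensteinPiRefinementDatum κ hm).map a b x := rfl

/-- `H¹` of the local presentation map is `D.mapH w a b`. [cite: Howard2004HeegnerKolyvagin, Def. 1.1.3 (arXiv p. 5 L93–99)] -/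
theorem map_piLocalMap_eq_mapH (a b : ℕ) :
    galoisCohomology.map (localIntertwining ((E.eisensteinPiRefinementDatum κ hm).levelRep a)
        ((E.eisensteinPiRefinementDatum κ hm).levelRep b) w ((E.eisensteinPiRefinementDatum κ hm).map a b).toAddMonoidHom
        ((E.eisensteinPiRefinementDatum κ hm).map_equivariant_toLocal w a b)) 1 =
      (E.eisensteinPiRefinementDatum κ hm).mapH w a b := rfl

/-- **The Eisenstein relation on the levels**: `π^m • x + p • x = 0` (`π^m + p = 0` in `S_𝔮 = Λ/(T^m + p)`).
[cite: Howard2004HeegnerKolyvagin, proof of Thm. 2.2.10 (𝔮 = T^m + p)] [cite: Washington1997, §13.2] -/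
theorem pi_pow_smul_add_natCast_zsmul_eq_zero (j : ℕ) (x : (E.eisensteinPiRefinementDatum κ hm).Level j) :
    (E.eisensteinPiRefinementDatum κ hm).π ^ m • x + ((p : ℕ) : ℤ) • x = 0 := by
  have hπ : (E.eisensteinPiRefinementDatum κ hm).π ^ m =
      -((p : ℕ) : IwasawaAlgebra p ⧸ Ideal.span {(PowerSeries.X ^ m + PowerSeries.C (p : ℤ_[p]) : IwasawaAlgebra p)}) := by
    rw [E.eisensteinPiRefinementDatum_π κ hm, IwasawaAlgebra.natCast_eq_neg_mk_X_pow_quotient_X_pow_add_C p m, neg_neg]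
  rw [hπ, neg_smul, Nat.cast_smul_eq_nsmul, natCast_zsmul, neg_add_cancel]

/-- **The plus parts of the `π`-adic levels are `S_𝔮`-stable** (`Fil_w T_𝔮` is an `S_𝔮`-submodule).
[cite: Howard2004HeegnerKolyvagin, Def. 1.1.1 and §3.1 (arXiv p. 5 L20–21, p. 15: Fil_v T_𝔮 an S_𝔮-submodule)] -/
theorem smul_mem_piFil (j : ℕ)
    (r : IwasawaAlgebra p ⧸ Ideal.span {(PowerSeries.X ^ m + PowerSeries.C (p : ℤ_[p]) : IwasawaAlgebra p)})
    (x : (E.eisensteinPiRefinementDatum κ hm).Level j) (hx : x ∈ E.piFil κ hm Φ j) : r • x ∈ E.piFil κ hm Φ j := by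
  obtain ⟨y, hy, rfl⟩ := (E.mem_piFil_iff κ hm Φ j x).mp hx
  obtain ⟨f, rfl⟩ := Ideal.Quotient.mk_surjective r
  rw [← Submodule.Quotient.mk_smul, ZpExtension.EisensteinLevel.quotient_mk_smul_def]
  exact (E.mem_piFil_iff κ hm Φ j _).mpr ⟨_, Φ.smul_mem_twistedFil _ _ hy, rfl⟩

/-- The local `H¹` of the `π`-adic levels is finite (finite coefficients over a local field).
[cite: SerreGaloisCohomology1997, II §5.2 Prop. 14] -/
theorem finite_galoisCohomology_toLocal_piLevel (i : ℕ) :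
    Finite (galoisCohomology (GaloisRep.toLocal w ((E.eisensteinPiRefinementDatum κ hm).levelRep i)) 1) := by
  haveI := E.finite_eisensteinPiRefinementDatum_level κ hm i
  exact finite_galoisCohomology_one_adicCompletion w _

/-- The local `H¹` of the graded `π`-adic levels `Level i ⧸ piFil i` is finite. [cite: SerreGaloisCohomology1997, II §5.2 Prop. 14] -/
theorem finite_galoisCohomology_toLocal_piLevel_quotient (i : ℕ) :
    Finite (galoisCohomology ((GaloisRep.toLocal w ((E.eisensteinPiRefinementDatum κ hm).levelRep i)).quotient
      (E.piFil κ hm Φ i) (E.piFil_le_comap κ hm Φ i)) 1) := by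
  haveI := E.finite_eisensteinPiRefinementDatum_level κ hm i
  exact finite_galoisCohomology_one_adicCompletion w _

/-! ## §2 (hTor-inst) -/

variable {g₀ : absoluteGaloisGroup (w.adicCompletion K)} {s : ℕ}

/-- **«`π^{2p^s}` kills `H⁰(K_w, gr_w(T/π^iT))`» in the quotient-endomorphism currency**: every `Γ_{K_w}`-invariant of
`Level d ⧸ piFil d` is killed by any endomorphism `πq d (2p^s)` acting as `[x] ↦ [π^{2p^s} x]` ((F4a) repackaged).
[cite: Howard2004HeegnerKolyvagin, §1.3 H.5(b) and §3.1 (arXiv p. 7 L96–97, p. 15)] [cite: GreenbergLNM1716, §2 and proof of Prop. 4.15] -/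
theorem piQuotPow_apply_eq_zero_of_forall_quotient_apply_eq
    (hg₀ : (κ (absGaloisRestrict K (w.adicCompletion K) g₀)).toAdd = ((p ^ s : ℕ) : ℤ_[p])) (hms : 2 * p ^ s < m)
    {πq : ∀ j (n : ℕ), ((GaloisRep.toLocal w ((E.eisensteinPiRefinementDatum κ hm).levelRep j)).quotient
        (E.piFil κ hm Φ j) (E.piFil_le_comap κ hm Φ j)).toContRepresentation →ⁱL
      ((GaloisRep.toLocal w ((E.eisensteinPiRefinementDatum κ hm).levelRep j)).quotient
        (E.piFil κ hm Φ j) (E.piFil_le_comap κ hm Φ j)).toContRepresentation}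
    (hπq : ∀ j n (x : (E.eisensteinPiRefinementDatum κ hm).Level j),
      πq j n (Submodule.Quotient.mk x) = Submodule.Quotient.mk ((E.eisensteinPiRefinementDatum κ hm).π ^ n • x))
    (d : ℕ) (y : (E.eisensteinPiRefinementDatum κ hm).Level d ⧸ E.piFil κ hm Φ d)
    (hy : ∀ σ : absoluteGaloisGroup (w.adicCompletion K),
      (GaloisRep.toLocal w ((E.eisensteinPiRefinementDatum κ hm).levelRep d)).quotient (E.piFil κ hm Φ d)
        (E.piFil_le_comap κ hm Φ d) σ y = y) :
    πq d (2 * p ^ s) y = 0 := by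
  induction y using Submodule.Quotient.induction_on with
  | _ x =>
    rw [hπq, Submodule.Quotient.mk_eq_zero]
    refine Φ.pi_pow_smul_mem_piFil_of_forall_toLocal_levelRep_sub_mem E κ hm hg₀ hms d x fun σ ↦ ?_
    have h := hy σ
    rw [ContinuousRep.quotient_apply_mk, Submodule.Quotient.eq] at h
    exact h

/-- **(hTor-inst)** — the first `H¹`-hypothesis of F2 `Tower.map_levelCondition_eq_map_comap_strict` for the curve's `π`-adic
Eisenstein tower at `w` (binders `q hq πq hπq` as in F2), with `r := 2p^s` (`κ(g₀) = p^s`, `2p^s < m`): a family of local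
classes of the graded levels, compatible under the reductions and killed levelwise by `p^a`, is killed by the `H¹(πq j (2p^s))`.
[cite: Howard2004HeegnerKolyvagin, §1.3 H.5(b), §1.6, §3.1 and Lemma 3.2.7 (arXiv p. 7 L96–97, p. 12, p. 15–16)]
[cite: GreenbergLNM1716, §2 and proof of Prop. 4.15] [cite: SerreGaloisCohomology1997, Ch. I §2.2] -/
theorem piTorsionCut_hTor
    (hFsurj : ∀ (k : ℕ) (y : geomTorsion E ((p : ℤ) ^ k)), y ∈ Φ.fil k →
      ∃ y' ∈ Φ.fil (k + 1), E.torsionGaloisModuleReduce p k y' = y)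
    (hbasis : ∀ k, 1 ≤ k → ∃ e : geomTorsion E ((p : ℤ) ^ k) ≃+ (Fin 2 → ZMod (p ^ k)), ∀ x, x ∈ Φ.fil k ↔ e x 1 = 0)
    (hg₀ : (κ (absGaloisRestrict K (w.adicCompletion K) g₀)).toAdd = ((p ^ s : ℕ) : ℤ_[p])) (hms : 2 * p ^ s < m)
    {q : ∀ a b, ((GaloisRep.toLocal w ((E.eisensteinPiRefinementDatum κ hm).levelRep a)).quotient
        (E.piFil κ hm Φ a) (E.piFil_le_comap κ hm Φ a)).toContRepresentation →ⁱL
      ((GaloisRep.toLocal w ((E.eisensteinPiRefinementDatum κ hm).levelRep b)).quotient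
        (E.piFil κ hm Φ b) (E.piFil_le_comap κ hm Φ b)).toContRepresentation}
    (hq : ∀ a b (x : (E.eisensteinPiRefinementDatum κ hm).Level a),
      q a b (Submodule.Quotient.mk x) = Submodule.Quotient.mk ((E.eisensteinPiRefinementDatum κ hm).map a b x))
    {πq : ∀ j (n : ℕ), ((GaloisRep.toLocal w ((E.eisensteinPiRefinementDatum κ hm).levelRep j)).quotient
        (E.piFil κ hm Φ j) (E.piFil_le_comap κ hm Φ j)).toContRepresentation →ⁱL
      ((GaloisRep.toLocal w ((E.eisensteinPiRefinementDatum κ hm).levelRep j)).quotient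
        (E.piFil κ hm Φ j) (E.piFil_le_comap κ hm Φ j)).toContRepresentation}
    (hπq : ∀ j n (x : (E.eisensteinPiRefinementDatum κ hm).Level j),
      πq j n (Submodule.Quotient.mk x) = Submodule.Quotient.mk ((E.eisensteinPiRefinementDatum κ hm).π ^ n • x)) :
    ∀ w' ∈ compatibleFamilies
        (H := fun j ↦ galoisCohomology ((GaloisRep.toLocal w ((E.eisensteinPiRefinementDatum κ hm).levelRep j)).quotient
          (E.piFil κ hm Φ j) (E.piFil_le_comap κ hm Φ j)) 1)
        (fun j ↦ galoisCohomology.map (q (j + 1) j) 1),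
      ∀ a : ℕ, (∀ j, p ^ a • w' j = 0) → ∀ j, galoisCohomology.map (πq j (2 * p ^ s)) 1 (w' j) = 0 :=
  forall_quot_map_quotPow_eq_zero_of_forall_pow_smul_eq_zero
    (ρ := fun j ↦ GaloisRep.toLocal w ((E.eisensteinPiRefinementDatum κ hm).levelRep j))
    (f := fun a b ↦ localIntertwining ((E.eisensteinPiRefinementDatum κ hm).levelRep a)
      ((E.eisensteinPiRefinementDatum κ hm).levelRep b) w ((E.eisensteinPiRefinementDatum κ hm).map a b).toAddMonoidHom
      ((E.eisensteinPiRefinementDatum κ hm).map_equivariant_toLocal w a b))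
    hq hπq
    (fun a b r x ↦ ((E.eisensteinPiRefinementDatum κ hm).map a b).map_smul r x)
    (fun a x ↦ (E.eisensteinPiRefinementDatum κ hm).map_self a x)
    (fun _ _ _ hcb hba x ↦ (E.eisensteinPiRefinementDatum κ hm).map_map_of_le hcb hba x)
    (fun ℓ n ↦ (E.eisensteinPiRefinementDatum κ hm).map_surjective ℓ n)
    (fun ℓ n y ↦ (E.eisensteinPiRefinementDatum κ hm).map_eq_zero_iff ℓ n y)
    (fun ℓ n x ↦ (E.eisensteinPiRefinementDatum κ hm).map_map_smul ℓ n x)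
    (fun a b _ hy ↦ E.map_mem_piFil κ hm Φ hFsurj a b hy)
    (fun ℓ n _ hy' ↦ E.exists_mem_piFil_map_eq κ hm Φ hFsurj ℓ n hy')
    (fun ℓ n y hy ↦ E.mem_piFil_of_map_mem κ hm Φ hFsurj hbasis ℓ n y hy)
    p (fun j x ↦ E.pi_pow_smul_add_natCast_zsmul_eq_zero κ hm j x) (2 * p ^ s)
    (fun d y hy ↦ E.piQuotPow_apply_eq_zero_of_forall_quotient_apply_eq κ hm w Φ hg₀ hms hπq d y hy)

/-! ## §3 (hF2-inst) -/

/-- The endomorphisms `π^c •` of the plus parts `piFil i`, as equivariant endomorphisms of the local subrepresentations, exist.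
[cite: Howard2004HeegnerKolyvagin, Def. 1.1.1 and §3.1 (arXiv p. 5 L20–21, p. 15)] -/
theorem exists_piFil_subPowFamily_apply (c : ℕ) :
    ∃ t : ∀ j, ((GaloisRep.toLocal w ((E.eisensteinPiRefinementDatum κ hm).levelRep j)).subrepresentation
        (E.piFil κ hm Φ j) (E.piFil_le_comap κ hm Φ j)).toContRepresentation →ⁱL
      ((GaloisRep.toLocal w ((E.eisensteinPiRefinementDatum κ hm).levelRep j)).subrepresentation
        (E.piFil κ hm Φ j) (E.piFil_le_comap κ hm Φ j)).toContRepresentation,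
      ∀ j (x : E.piFil κ hm Φ j), ((t j x : E.piFil κ hm Φ j) : (E.eisensteinPiRefinementDatum κ hm).Level j) =
        (E.eisensteinPiRefinementDatum κ hm).π ^ c • (x : (E.eisensteinPiRefinementDatum κ hm).Level j) :=
  exists_subPowFamily_apply (ρ := fun j ↦ GaloisRep.toLocal w ((E.eisensteinPiRefinementDatum κ hm).levelRep j))
    (hΓ := E.piFil_le_comap κ hm Φ)
    (fun j ↦ ((E.eisensteinPiRefinementDatum κ hm).isScalarLinear_levelRep j).restrictField _)
    (fun j r x hx ↦ E.smul_mem_piFil κ hm w Φ j r x hx) c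

/-- **(hF2-inst)** — the second `H¹`-hypothesis of F2 for the curve's `π`-adic Eisenstein tower at `w` (binders `πq hπq`, and an
endomorphism family `t` of the plus parts acting as `π^c`, e.g. from `exists_piFil_subPowFamily_apply`): if `H²(t i) = 0` on the
local `H²(K_w, piFil i)` (`hH2Fil`, (F4c)), then every `H¹(πq j c) w'` lifts along `H¹(K_w, Level j) → H¹(K_w, Level j ⧸ piFil j)`.
[cite: Howard2004HeegnerKolyvagin, §1.3 H.5(b) and §3.1 (arXiv p. 7 L96–97, p. 15)] [cite: SerreGaloisCohomology1997, Ch. I §2.2–2.3] -/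
theorem piTorsionCut_hF2
    {πq : ∀ j (n : ℕ), ((GaloisRep.toLocal w ((E.eisensteinPiRefinementDatum κ hm).levelRep j)).quotient
        (E.piFil κ hm Φ j) (E.piFil_le_comap κ hm Φ j)).toContRepresentation →ⁱL
      ((GaloisRep.toLocal w ((E.eisensteinPiRefinementDatum κ hm).levelRep j)).quotient
        (E.piFil κ hm Φ j) (E.piFil_le_comap κ hm Φ j)).toContRepresentation}
    (hπq : ∀ j n (x : (E.eisensteinPiRefinementDatum κ hm).Level j),
      πq j n (Submodule.Quotient.mk x) = Submodule.Quotient.mk ((E.eisensteinPiRefinementDatum κ hm).π ^ n • x))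
    (t : ∀ j, ((GaloisRep.toLocal w ((E.eisensteinPiRefinementDatum κ hm).levelRep j)).subrepresentation
        (E.piFil κ hm Φ j) (E.piFil_le_comap κ hm Φ j)).toContRepresentation →ⁱL
      ((GaloisRep.toLocal w ((E.eisensteinPiRefinementDatum κ hm).levelRep j)).subrepresentation
        (E.piFil κ hm Φ j) (E.piFil_le_comap κ hm Φ j)).toContRepresentation)
    (c : ℕ)
    (ht : ∀ j (x : E.piFil κ hm Φ j), ((t j x : E.piFil κ hm Φ j) : (E.eisensteinPiRefinementDatum κ hm).Level j) =
        (E.eisensteinPiRefinementDatum κ hm).π ^ c • (x : (E.eisensteinPiRefinementDatum κ hm).Level j))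
    (hH2Fil : ∀ j (z : galoisCohomology ((GaloisRep.toLocal w ((E.eisensteinPiRefinementDatum κ hm).levelRep j)).subrepresentation
        (E.piFil κ hm Φ j) (E.piFil_le_comap κ hm Φ j)) 2), galoisCohomology.map (t j) 2 z = 0)
    (j : ℕ) (w' : galoisCohomology ((GaloisRep.toLocal w ((E.eisensteinPiRefinementDatum κ hm).levelRep j)).quotient
      (E.piFil κ hm Φ j) (E.piFil_le_comap κ hm Φ j)) 1) :
    ∃ z : galoisCohomology (GaloisRep.toLocal w ((E.eisensteinPiRefinementDatum κ hm).levelRep j)) 1,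
      DiscreteGaloisModule.quotientMap (GaloisRep.toLocal w ((E.eisensteinPiRefinementDatum κ hm).levelRep j))
          (E.piFil κ hm Φ j) (E.piFil_le_comap κ hm Φ j) 1 z = galoisCohomology.map (πq j c) 1 w' :=
  exists_quotientMap_eq_map_quotPow_of_map_two_eq_zero
    (ρ := fun j ↦ GaloisRep.toLocal w ((E.eisensteinPiRefinementDatum κ hm).levelRep j))
    (fun j ↦ ((E.eisensteinPiRefinementDatum κ hm).isScalarLinear_levelRep j).restrictField _) hπq t c ht hH2Fil j w'

/-! ## §4 (hLift-inst) -/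

/-- **(hLift-inst)** — the third `H¹`-hypothesis of F2 for the curve's `π`-adic Eisenstein tower at `w`: if `H²(π^{c'} •) = 0` on
the local `H²(K_w, Level j)` of every level (`hH2`, (F4c)), then for `c' ≤ N` every local class `y ∈ H¹(K_w, Level N)` agrees,
after the reduction `H¹(f N (N − c')) = D.mapH w N (N − c')`, with the `N`-component of a COMPATIBLE family of local classes.
[cite: Howard2004HeegnerKolyvagin, §1.3 H.5(b), §1.6 and Lemma 3.2.7 (arXiv p. 7 L96–97, p. 12 L29–55, p. 16)]
[cite: SerreGaloisCohomology1997, Ch. I §2.2–2.3 and II §5.2] -/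
theorem piTorsionCut_hLift {c' N : ℕ} (hc' : c' ≤ N)
    (hH2 : ∀ j (z : galoisCohomology (GaloisRep.toLocal w ((E.eisensteinPiRefinementDatum κ hm).levelRep j)) 2),
      galoisCohomology.scalarMap (GaloisRep.toLocal w ((E.eisensteinPiRefinementDatum κ hm).levelRep j))
        (((E.eisensteinPiRefinementDatum κ hm).isScalarLinear_levelRep j).restrictField _) 2
        ((E.eisensteinPiRefinementDatum κ hm).π ^ c') z = 0)
    (y : galoisCohomology (GaloisRep.toLocal w ((E.eisensteinPiRefinementDatum κ hm).levelRep N)) 1) :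
    ∃ x ∈ compatibleFamilies
        (H := fun j ↦ galoisCohomology (GaloisRep.toLocal w ((E.eisensteinPiRefinementDatum κ hm).levelRep j)) 1)
        (fun j ↦ galoisCohomology.map (localIntertwining ((E.eisensteinPiRefinementDatum κ hm).levelRep (j + 1))
          ((E.eisensteinPiRefinementDatum κ hm).levelRep j) w ((E.eisensteinPiRefinementDatum κ hm).map (j + 1) j).toAddMonoidHom
          ((E.eisensteinPiRefinementDatum κ hm).map_equivariant_toLocal w (j + 1) j)) 1),
      galoisCohomology.map (localIntertwining ((E.eisensteinPiRefinementDatum κ hm).levelRep N)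
          ((E.eisensteinPiRefinementDatum κ hm).levelRep (N - c')) w ((E.eisensteinPiRefinementDatum κ hm).map N (N - c')).toAddMonoidHom
          ((E.eisensteinPiRefinementDatum κ hm).map_equivariant_toLocal w N (N - c'))) 1 (x N) =
        galoisCohomology.map (localIntertwining ((E.eisensteinPiRefinementDatum κ hm).levelRep N)
          ((E.eisensteinPiRefinementDatum κ hm).levelRep (N - c')) w ((E.eisensteinPiRefinementDatum κ hm).map N (N - c')).toAddMonoidHom
          ((E.eisensteinPiRefinementDatum κ hm).map_equivariant_toLocal w N (N - c'))) 1 y := by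
  haveI : ∀ j, Finite (galoisCohomology (GaloisRep.toLocal w ((E.eisensteinPiRefinementDatum κ hm).levelRep j)) 1) :=
    fun j ↦ E.finite_galoisCohomology_toLocal_piLevel κ hm w j
  exact exists_mem_compatibleFamilies_map_sub_eq_map_sub_of_scalarMap_two_eq_zero
    (ρ := fun j ↦ GaloisRep.toLocal w ((E.eisensteinPiRefinementDatum κ hm).levelRep j))
    (f := fun a b ↦ localIntertwining ((E.eisensteinPiRefinementDatum κ hm).levelRep a)
      ((E.eisensteinPiRefinementDatum κ hm).levelRep b) w ((E.eisensteinPiRefinementDatum κ hm).map a b).toAddMonoidHom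
      ((E.eisensteinPiRefinementDatum κ hm).map_equivariant_toLocal w a b))
    (fun j ↦ ((E.eisensteinPiRefinementDatum κ hm).isScalarLinear_levelRep j).restrictField _)
    (fun a b r x ↦ ((E.eisensteinPiRefinementDatum κ hm).map a b).map_smul r x)
    (fun a x ↦ (E.eisensteinPiRefinementDatum κ hm).map_self a x)
    (fun _ _ _ hcb hba x ↦ (E.eisensteinPiRefinementDatum κ hm).map_map_of_le hcb hba x)
    (fun _ _ hab x ↦ (E.eisensteinPiRefinementDatum κ hm).map_map_succ hab x)
    (fun ℓ n ↦ (E.eisensteinPiRefinementDatum κ hm).map_injective ℓ n)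
    (fun ℓ n ↦ (E.eisensteinPiRefinementDatum κ hm).map_surjective ℓ n)
    (fun ℓ n y ↦ (E.eisensteinPiRefinementDatum κ hm).map_eq_zero_iff ℓ n y)
    (fun ℓ n x ↦ (E.eisensteinPiRefinementDatum κ hm).map_map_smul ℓ n x)
    hc' hH2 y

/-! ## §5 The binders of F3 discharged for the curve's ordinary datum `Φ := E.ordinaryFiltrationAt w` -/

/-- **(hFsurj) for `Φ := ordinaryFiltrationAt`**: `×p : Fil_w E[p^{k+1}] → Fil_w E[p^k]` is onto at a place `w ∋ p` of good
reduction with an ordinary point (tree `exists_mem_torsionFilAt_reduce_eq`, `Fil_w` being the kernel of reduction).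
[cite: GreenbergLNM1716, §2 p. 82] [cite: Howard2004HeegnerKolyvagin, Def. 3.2.5–3.2.6 (arXiv p. 16)] -/
theorem ordinaryFiltrationAt_hFsurj (hgood : E.HasGoodReductionAt w) (hpw : (p : 𝓞 K) ∈ w.asIdeal)
    (hord : ∃ P : localPoints E (w.adicCompletion K), (p : ℤ) • P = 0 ∧ P ∉ E.localKernelOfReduction w)
    (k : ℕ) (y : geomTorsion E ((p : ℤ) ^ k))
    (hy : y ∈ (E.ordinaryFiltrationAt w (fun j ↦ E.torsionGaloisModuleReduce p j) (fun _ _ ↦ rfl)).fil k) :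
    ∃ y' ∈ (E.ordinaryFiltrationAt w (fun j ↦ E.torsionGaloisModuleReduce p j) (fun _ _ ↦ rfl)).fil (k + 1),
      E.torsionGaloisModuleReduce p k y' = y :=
  E.exists_mem_torsionFilAt_reduce_eq w hgood hpw hord (fun j ↦ E.torsionGaloisModuleReduce p j) (fun _ _ ↦ rfl) k y hy

/-- **(hbasis) for `Φ := ordinaryFiltrationAt`**: adapted bases of the `E[p^k]` (`Fil_w` a rank-one direct summand), `k ≥ 1`
(tree `exists_addEquiv_mem_torsionFilAt_iff`). [cite: Howard2004HeegnerKolyvagin, H.0 and §3.1 (arXiv p. 7 L57, p. 15 L56–62)]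
[cite: GreenbergLNM1716, §2] -/
theorem ordinaryFiltrationAt_hbasis (hgood : E.HasGoodReductionAt w) (hpw : (p : 𝓞 K) ∈ w.asIdeal)
    (hord : ∃ P : localPoints E (w.adicCompletion K), (p : ℤ) • P = 0 ∧ P ∉ E.localKernelOfReduction w)
    (k : ℕ) (hk : 1 ≤ k) :
    ∃ e : geomTorsion E ((p : ℤ) ^ k) ≃+ (Fin 2 → ZMod (p ^ k)),
      ∀ x, x ∈ (E.ordinaryFiltrationAt w (fun j ↦ E.torsionGaloisModuleReduce p j) (fun _ _ ↦ rfl)).fil k ↔ e x 1 = 0 :=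
  E.exists_addEquiv_mem_torsionFilAt_iff w hgood hpw hord hk

/-- **(hTor-inst) for the curve's ordinary datum `Φ := E.ordinaryFiltrationAt w`** at a place `w ∋ p` of good reduction with an
ordinary point: F2's first `H¹`-hypothesis with `r := 2p^s` (`κ(g₀) = p^s`, `2p^s < m`), the F3-binders `hFsurj`/`hbasis`
discharged by `ordinaryFiltrationAt_hFsurj`/`_hbasis`. [cite: Howard2004HeegnerKolyvagin, §1.3 H.5(b), §3.1, Def. 3.2.5 and Lemma 3.2.7 (arXiv p. 7 L96–97, p. 15–16)]
[cite: GreenbergLNM1716, §2 and proof of Prop. 4.15] -/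
theorem piTorsionCut_hTor_ordinaryFiltrationAt (hgood : E.HasGoodReductionAt w) (hpw : (p : 𝓞 K) ∈ w.asIdeal)
    (hord : ∃ P : localPoints E (w.adicCompletion K), (p : ℤ) • P = 0 ∧ P ∉ E.localKernelOfReduction w)
    (hg₀ : (κ (absGaloisRestrict K (w.adicCompletion K) g₀)).toAdd = ((p ^ s : ℕ) : ℤ_[p])) (hms : 2 * p ^ s < m)
    {q : ∀ a b, ((GaloisRep.toLocal w ((E.eisensteinPiRefinementDatum κ hm).levelRep a)).quotient
        (E.piFil κ hm (E.ordinaryFiltrationAt w (fun j ↦ E.torsionGaloisModuleReduce p j) (fun _ _ ↦ rfl)) a)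
        (E.piFil_le_comap κ hm (E.ordinaryFiltrationAt w (fun j ↦ E.torsionGaloisModuleReduce p j) (fun _ _ ↦ rfl))
          a)).toContRepresentation →ⁱL
      ((GaloisRep.toLocal w ((E.eisensteinPiRefinementDatum κ hm).levelRep b)).quotient
        (E.piFil κ hm (E.ordinaryFiltrationAt w (fun j ↦ E.torsionGaloisModuleReduce p j) (fun _ _ ↦ rfl)) b)
        (E.piFil_le_comap κ hm (E.ordinaryFiltrationAt w (fun j ↦ E.torsionGaloisModuleReduce p j) (fun _ _ ↦ rfl))
          b)).toContRepresentation}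
    (hq : ∀ a b (x : (E.eisensteinPiRefinementDatum κ hm).Level a),
      q a b (Submodule.Quotient.mk x) = Submodule.Quotient.mk ((E.eisensteinPiRefinementDatum κ hm).map a b x))
    {πq : ∀ j (n : ℕ), ((GaloisRep.toLocal w ((E.eisensteinPiRefinementDatum κ hm).levelRep j)).quotient
        (E.piFil κ hm (E.ordinaryFiltrationAt w (fun j ↦ E.torsionGaloisModuleReduce p j) (fun _ _ ↦ rfl)) j)
        (E.piFil_le_comap κ hm (E.ordinaryFiltrationAt w (fun j ↦ E.torsionGaloisModuleReduce p j) (fun _ _ ↦ rfl))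
          j)).toContRepresentation →ⁱL
      ((GaloisRep.toLocal w ((E.eisensteinPiRefinementDatum κ hm).levelRep j)).quotient
        (E.piFil κ hm (E.ordinaryFiltrationAt w (fun j ↦ E.torsionGaloisModuleReduce p j) (fun _ _ ↦ rfl)) j)
        (E.piFil_le_comap κ hm (E.ordinaryFiltrationAt w (fun j ↦ E.torsionGaloisModuleReduce p j) (fun _ _ ↦ rfl))
          j)).toContRepresentation}
    (hπq : ∀ j n (x : (E.eisensteinPiRefinementDatum κ hm).Level j),
      πq j n (Submodule.Quotient.mk x) = Submodule.Quotient.mk ((E.eisensteinPiRefinementDatum κ hm).π ^ n • x)) :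
    ∀ w' ∈ compatibleFamilies
        (H := fun j ↦ galoisCohomology ((GaloisRep.toLocal w ((E.eisensteinPiRefinementDatum κ hm).levelRep j)).quotient
          (E.piFil κ hm (E.ordinaryFiltrationAt w (fun j ↦ E.torsionGaloisModuleReduce p j) (fun _ _ ↦ rfl)) j)
          (E.piFil_le_comap κ hm (E.ordinaryFiltrationAt w (fun j ↦ E.torsionGaloisModuleReduce p j) (fun _ _ ↦ rfl))
            j)) 1)
        (fun j ↦ galoisCohomology.map (q (j + 1) j) 1),
      ∀ a : ℕ, (∀ j, p ^ a • w' j = 0) → ∀ j, galoisCohomology.map (πq j (2 * p ^ s)) 1 (w' j) = 0 :=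
  E.piTorsionCut_hTor κ hm w (E.ordinaryFiltrationAt w (fun j ↦ E.torsionGaloisModuleReduce p j) (fun _ _ ↦ rfl))
    (E.ordinaryFiltrationAt_hFsurj w hgood hpw hord) (E.ordinaryFiltrationAt_hbasis w hgood hpw hord) hg₀ hms hq hπq

end WeierstrassCurve

end
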